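import Summits.HubbardSuperconductivity.HubbardSuperconductivity.Theorems.KLProgrammeKLRegimeFlowReadScaleZeroSunsetFarRowsSup
import Summits.HubbardSuperconductivity.HubbardSuperconductivity.Theorems.KLProgrammeKLRegimeFlowReadScaleZeroSunsetCertRowsTwoShells

/-!
# Route `KLProgramme`, crux K3 — engine-flow child (stmt-HubbardSuperconductivity-20437), stub (C) at `n = 0`, located item #22a «(C)-SCALE0-PT2»,
# the FAR-SUP FAMILY `Ψ` OF `farRows_le_of_l2Far_sup` IN THE TWO-SHELLS FORM, and its β-UNIFORM frequency sum `S_far`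

Cell gate-hubbard-kl, seat p1 g22 (supplier).  `…SunsetFarRowsSup.farRows_le_of_l2Far_sup` replaces the Gram `16` of the far rows by
`S_far = (1/β)Σ_i Ψ i`, `Ψ i` a bound of the far sup `sup_{u far} ‖TFI_{ω_i}(u)‖`.  The two shells supply `Ψ` by name:
* §1 `mul_exp_neg_arsinh_le` — `ω ↦ ω·e^{−R′·arsinh(ω/4)}` is non-increasing on `[ω₁, ∞)` once `√(16+ω₁²) ≤ R′ω₁` (derivative
  `1/ω − R′/√(16+ω²) ≤ 0`), the device that turns ONE power `1/|ω|` plus the strip exponential into the summable `ω₁e^{−R′κ₁}/ω²`;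
* §2 `norm_torusFourierInv_far_le_strip` — HIGH shell, per frequency `klE0 ≤ |ω|` (`e^{−κL/2} ≤ 1/2`): at every far `u`,
  `‖TFI_ω(u)‖ ≤ 25·(2/|ω|)·e^{−κ(Rc+1)}`, `κ = arsinh(|ω|/4)` (p1 g21's strip door at the centred representative, `‖ũ‖∞ ≥ Rc+1`);
* §3 `sum_farSup_high_le` — `Σ_i [ω₁ ≤ |ω_i|]·25(2/|ω_i|)e^{−κ_i(Rc+1)} ≤ β·50·e^{−κ₁(Rc+1)}` for `klE0 ≤ ω₁`, `√(16+ω₁²) ≤ (Rc+1)ω₁`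
  (§1 with `R′ = Rc+1`, then `Σ_i 1/max(|ω_i|,ω₁)² ≤ β/ω₁`);
* §4 **`farSup_family_of_twoShells`** — the `hΨ` of `farRows_le_of_l2Far_sup` for the family
  `Ψ i := if ω₁ ≤ |ω_i| then 25(2/|ω_i|)e^{−κ_i(Rc+1)} else √(Dlow 0)` from the strip conditions and the row-`0` low-shell envelope `hlow₀`
  (`norm_torusFourierInv_le_sqrt_of_l2Far`); **`sum_farSup_family_le`** — `(1/β)Σ_i Ψ i ≤ 50·e^{−κ₁(Rc+1)} + ω₁·√(Dlow 0)` (§3 + k3c5's `sum_l2Far_low_le`).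
So the far rows of the two-shells closer can read `bS k ≥ row k + (50e^{−κ₁(Rc+1)} + ω₁√(Dlow 0))·(2ᵏ·2500·C(ω₁,Rc)/ω₁ + ω₁·Dlow k)` instead of the Gram
`16·(…)` — sizes [float heuristic, labelled]: `ω₁√(Dlow 0) ≈ 0.3·√(10⁻⁶…10⁻⁹) ≲ 3·10⁻⁴` against `16`.  The closer twin itself is the k3c5 lineage's.

No definitions; nothing here asserts (C), any stub of 20437, K3 or superconductivity.
References: BGM 2006 §2.2 footnote 1, §3 (3.2) [cite: BenfattoGiulianiMastropietro2006].
-/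

noncomputable section

namespace Summit.HubbardSuperconductivity.HubbardSuperconductivity.Theorems.KLRegimeSplit

set_option linter.dupNamespace false -- summit = problem name (single-conjunct summit), D-0017

open Literature.MathematicalPhysics.QuantumLattice Literature.Probability.LatticeModels Literature.Analysis.FunctionSpaces
open Summit.HubbardSuperconductivity.HubbardSuperconductivity.Theorems.DispersionFlow
open MeasureTheory Set Finset Complex Real
open scoped Nat

variable {L : ℕ} [NeZero L]

/-! ## §1 One power of `1/ω` plus the strip exponential is summable -/

omit [NeZero L] in
/-- **`b·e^{−R′·arsinh(b/4)} ≤ a·e^{−R′·arsinh(a/4)}` for `0 < a ≤ b` once `√(16 + a²) ≤ R′·a`**: the logarithm `ln ω − R′·arsinh(ω/4)` has derivative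
`1/ω − R′/√(16+ω²) ≤ 0` on `[a, ∞)` (`√(16+ω²)/ω` decreases). [folklore] -/
theorem mul_exp_neg_arsinh_le {R' a b : ℝ} (ha : 0 < a) (hab : a ≤ b) (hR : Real.sqrt (16 + a ^ 2) ≤ R' * a) :
    b * Real.exp (-(R' * Real.arsinh (b / 4))) ≤ a * Real.exp (-(R' * Real.arsinh (a / 4))) := by
  have hb : 0 < b := lt_of_lt_of_le ha hab
  -- the logarithmic form `fL(ω) = log ω − R′·arsinh(ω/4)` is antitone on `[a, ∞)`
  set fL : ℝ → ℝ := fun ω => Real.log ω - R' * Real.arsinh (ω / 4) with hfL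
  have hderiv : ∀ ω : ℝ, 0 < ω → HasDerivAt fL (1 / ω - R' * ((Real.sqrt (1 + (ω / 4) ^ 2))⁻¹ * (1 / 4))) ω := by
    intro ω hω
    have h1 : HasDerivAt Real.log (1 / ω) ω := by
      have := Real.hasDerivAt_log hω.ne'
      simpa [one_div] using this
    have hin : HasDerivAt (fun ω : ℝ => ω / 4) (1 / 4) ω := by
      simpa using (hasDerivAt_id ω).div_const 4
    have h2 := (Real.hasDerivAt_arsinh (ω / 4)).comp ω hin
    have h3 := h1.sub (h2.const_mul R')
    exact h3
  have hanti : AntitoneOn fL (Set.Ici a) := by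
    refine antitoneOn_of_deriv_nonpos (convex_Ici a) ?_ ?_ ?_
    · intro ω hω
      have hω0 : 0 < ω := lt_of_lt_of_le ha hω
      exact (hderiv ω hω0).continuousAt.continuousWithinAt
    · intro ω hω
      rw [interior_Ici] at hω
      have hω0 : 0 < ω := ha.trans hω
      exact (hderiv ω hω0).differentiableAt.differentiableWithinAt
    · intro ω hω
      rw [interior_Ici] at hω
      have hω0 : 0 < ω := ha.trans hω
      rw [(hderiv ω hω0).deriv]
      -- `1/ω ≤ R′/(4√(1+(ω/4)²)) ⟸ √(16+ω²) ≤ R′ω ⟸ √(16+a²) ≤ R′a` and `a ≤ ω`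
      have hsq : Real.sqrt (1 + (ω / 4) ^ 2) * 4 = Real.sqrt (16 + ω ^ 2) := by
        rw [show (16 + ω ^ 2 : ℝ) = (1 + (ω / 4) ^ 2) * 4 ^ 2 by ring, Real.sqrt_mul (by positivity), Real.sqrt_sq (by norm_num)]
      have hs0 : 0 < Real.sqrt (16 + ω ^ 2) := Real.sqrt_pos.2 (by positivity)
      have hRpos : 0 < R' := by
        have : 0 < Real.sqrt (16 + a ^ 2) := Real.sqrt_pos.2 (by positivity)
        nlinarith
      -- `√(16+ω²)·a ≤ √(16+a²)·ω` for `a ≤ ω`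
      have hmono : Real.sqrt (16 + ω ^ 2) * a ≤ Real.sqrt (16 + a ^ 2) * ω := by
        rw [← Real.sqrt_sq ha.le, ← Real.sqrt_sq hω0.le, ← Real.sqrt_mul (by positivity), ← Real.sqrt_mul (by positivity),
          Real.sqrt_sq ha.le, Real.sqrt_sq hω0.le]
        refine Real.sqrt_le_sqrt ?_
        nlinarith [mul_le_mul_of_nonneg_left hω.le (by norm_num : (0:ℝ) ≤ 16), sq_nonneg (ω - a), mul_pos ha hω0]
      have hkey : Real.sqrt (16 + ω ^ 2) ≤ R' * ω := by
        have := mul_le_mul_of_nonneg_right hR hω0.le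
        nlinarith
      rw [sub_nonpos, show R' * ((Real.sqrt (1 + (ω / 4) ^ 2))⁻¹ * (1 / 4)) = R' / (Real.sqrt (1 + (ω / 4) ^ 2) * 4) by ring, hsq,
        div_le_div_iff₀ hω0 hs0, one_mul]
      exact hkey
  have hφle : fL b ≤ fL a := hanti (Set.mem_Ici.2 le_rfl) (Set.mem_Ici.2 hab) hab
  -- exponentiate
  have ea : a * Real.exp (-(R' * Real.arsinh (a / 4))) = Real.exp (fL a) := by
    show _ = Real.exp (Real.log a - R' * Real.arsinh (a / 4))
    rw [Real.exp_sub, Real.exp_log ha, Real.exp_neg]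
    exact (div_eq_mul_inv _ _).symm
  have eb : b * Real.exp (-(R' * Real.arsinh (b / 4))) = Real.exp (fL b) := by
    show _ = Real.exp (Real.log b - R' * Real.arsinh (b / 4))
    rw [Real.exp_sub, Real.exp_log hb, Real.exp_neg]
    exact (div_eq_mul_inv _ _).symm
  rw [ea, eb]
  exact Real.exp_le_exp.2 hφle

/-! ## §2 High shell: the far sup from the strip door -/

/-- **HIGH-SHELL FAR SUP**: for `klE0 ≤ |ω|`, `e^{−κL/2} ≤ 1/2` (`κ = arsinh(|ω|/4)`) and every far `u` (`u ≠ 0`, `ũ ∉ disk`):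
`‖TFI_ω(u)‖ ≤ 25·(2/|ω|)·e^{−κ·(Rc+1)}`. -/
theorem norm_torusFourierInv_far_le_strip (c : SunsetCellRecordV2) (μ : ℝ) {om : ℝ} (hom : klE0 ≤ |om|)
    (hρ : Real.exp (-(Real.arsinh (|om| / 4) * L / 2)) ≤ 1 / 2)
    (u : TorusSite 2 L) (hu : u ≠ 0 ∧ (fun j => (u j).valMinAbs : Site 2) ∉ c.disk) :
    ‖torusFourierInv (fun kv : TorusSite 2 L =>
        (fun y : Momentum => uvSymbolFn 1 klE0 (frameLevel μ 0 ((2 * π) • y)) om) (WithLp.toLp 2 fun j => ((kv j).val : ℝ) / L)) u‖ ≤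
      25 * (2 / |om|) * Real.exp (-(Real.arsinh (|om| / 4) * (c.Rc + 1))) := by
  have hE0 : (0 : ℝ) < klE0 := by norm_num [klE0]
  set zc : Site 2 := fun j => (u j).valMinAbs with hzc
  have hproj : Torus.proj L zc = u := (two_mul_norm_valMinAbs_le u).1
  have hzcL : 2 * ‖zc‖ ≤ L := (two_mul_norm_valMinAbs_le u).2
  have hzc0 : zc ≠ 0 := by
    intro h0
    apply hu.1
    rw [← hproj, h0]
    funext j; simp [Literature.Probability.LatticeModels.Torus.proj_apply]
  have hfar : (c.Rc : ℝ) + 1 ≤ ‖zc‖ := by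
    have h := one_add_norm_ge_of_not_mem_disk c hzc0 hu.2
    linarith
  have hdoor := norm_torusFourierInv_uvSpatialSample_le_exp hE0 μ hom hzcL hρ
  rw [hproj] at hdoor
  refine hdoor.trans (mul_le_mul_of_nonneg_left ?_ (by positivity))
  rw [Real.exp_le_exp]
  have hκ0 : 0 < Real.arsinh (|om| / 4) := Real.arsinh_pos_iff.2 (by have := hE0.trans_le hom; positivity)
  nlinarith

/-! ## §3 High shell summed over the window, β-uniform -/

omit [NeZero L] in
/-- **`Σ_i [ω₁ ≤ |ω_i|]·25·(2/|ω_i|)·e^{−κ_i(Rc+1)} ≤ β·50·e^{−κ₁(Rc+1)}`** for `0 < β`, `klE0 ≤ ω₁`, `√(16+ω₁²) ≤ (Rc+1)·ω₁` (`κ₁ = arsinh(ω₁/4)`):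
§1 gives `25(2/|ω_i|)e^{−κ_i(Rc+1)} ≤ 50ω₁e^{−κ₁(Rc+1)}/max(|ω_i|,ω₁)²`, and `Σ_i 1/max(|ω_i|,ω₁)² ≤ β/ω₁`. -/
theorem sum_farSup_high_le {M : ℕ} {β ω₁ : ℝ} (hβ : 0 < β) (hω₁ : klE0 ≤ ω₁) (Rc : ℕ)
    (hR : Real.sqrt (16 + ω₁ ^ 2) ≤ ((Rc : ℝ) + 1) * ω₁) :
    ∑ i : MatsubaraIdx M, (if ω₁ ≤ |matsubaraFreq β M i| then
        25 * (2 / |matsubaraFreq β M i|) * Real.exp (-(Real.arsinh (|matsubaraFreq β M i| / 4) * (Rc + 1))) else 0) ≤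
      β * (50 * Real.exp (-(Real.arsinh (ω₁ / 4) * (Rc + 1)))) := by
  have hE0 : (0 : ℝ) < klE0 := by norm_num [klE0]
  have hω₁0 : 0 < ω₁ := lt_of_lt_of_le hE0 hω₁
  set E : ℝ := Real.exp (-(Real.arsinh (ω₁ / 4) * (Rc + 1))) with hE
  have hterm : ∀ i : MatsubaraIdx M, (if ω₁ ≤ |matsubaraFreq β M i| then
        25 * (2 / |matsubaraFreq β M i|) * Real.exp (-(Real.arsinh (|matsubaraFreq β M i| / 4) * (Rc + 1))) else 0) ≤
      (50 * ω₁ * E) * (1 / max |matsubaraFreq β M i| ω₁ ^ 2) := by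
    intro i
    split_ifs with hi
    · have hom0 : 0 < |matsubaraFreq β M i| := lt_of_lt_of_le hω₁0 hi
      have hmax : max |matsubaraFreq β M i| ω₁ = |matsubaraFreq β M i| := max_eq_left hi
      rw [hmax]
      -- §1 with `R′ = Rc+1`, `a = ω₁`, `b = |ω_i|`
      have hmon := mul_exp_neg_arsinh_le (R' := (Rc : ℝ) + 1) hω₁0 hi hR
      have e1 : 25 * (2 / |matsubaraFreq β M i|) * Real.exp (-(Real.arsinh (|matsubaraFreq β M i| / 4) * (Rc + 1))) =
          50 * (|matsubaraFreq β M i| * Real.exp (-(((Rc : ℝ) + 1) * Real.arsinh (|matsubaraFreq β M i| / 4)))) *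
            (1 / |matsubaraFreq β M i| ^ 2) := by
        field_simp
        ring_nf
      have e2 : (50 * ω₁ * E) * (1 / |matsubaraFreq β M i| ^ 2) =
          50 * (ω₁ * Real.exp (-(((Rc : ℝ) + 1) * Real.arsinh (ω₁ / 4)))) * (1 / |matsubaraFreq β M i| ^ 2) := by
        simp only [hE]; ring_nf
      rw [e1, e2]
      exact mul_le_mul_of_nonneg_right (mul_le_mul_of_nonneg_left hmon (by norm_num)) (by positivity)
    · positivity
  refine (Finset.sum_le_sum fun i _ => hterm i).trans ?_
  rw [← Finset.mul_sum]
  calc 50 * ω₁ * E * ∑ i : MatsubaraIdx M, 1 / max |matsubaraFreq β M i| ω₁ ^ 2 ≤ 50 * ω₁ * E * (β / ω₁) :=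
        mul_le_mul_of_nonneg_left (sum_inv_max_sq_matsubaraIdx_le hβ hω₁0 M) (by positivity)
    _ = β * (50 * E) := by field_simp

/-! ## §4 The two-shells far-sup family and its frequency sum -/

/-- **THE FAR-SUP FAMILY OF THE TWO SHELLS** (the `hΨ` of `farRows_le_of_l2Far_sup`): with
`Ψ i := if ω₁ ≤ |ω_i| then 25(2/|ω_i|)e^{−κ_i(Rc+1)} else √(Dlow 0)` — high shell from the strip door (`klE0 ≤ ω₁`, `e^{−κ₁L/2} ≤ 1/2`), low shell from the
row-`0` envelope `hlow₀` (one term ≤ the sum) — every far `u` has `‖TFI_{ω_i}(u)‖ ≤ Ψ i`, and `0 ≤ Ψ i`. -/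
theorem farSup_family_of_twoShells {M : ℕ} (c : SunsetCellRecordV2) (μ : ℝ) {β ω₁ : ℝ} (hω₁ : klE0 ≤ ω₁)
    (hρ : Real.exp (-(Real.arsinh (ω₁ / 4) * L / 2)) ≤ 1 / 2) {Dlow0 : ℝ}
    (hlow₀ : ∀ i : MatsubaraIdx M, |matsubaraFreq β M i| < ω₁ →
      ∑ u : TorusSite 2 L,
        (if u ≠ 0 ∧ (fun j => (u j).valMinAbs : Site 2) ∉ c.disk then
          Real.sqrt ((((u 0).valMinAbs.natAbs : ℝ)) ^ 2 + (((u 1).valMinAbs.natAbs : ℝ)) ^ 2) ^ ((0 : Fin 3) : ℕ) *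
            ‖torusFourierInv (fun kv : TorusSite 2 L =>
              (fun y : Momentum => uvSymbolFn 1 klE0 (frameLevel μ 0 ((2 * π) • y)) (matsubaraFreq β M i))
                (WithLp.toLp 2 fun j => ((kv j).val : ℝ) / L)) u‖ ^ 2
          else 0) ≤ Dlow0) :
    (∀ i : MatsubaraIdx M, ∀ u : TorusSite 2 L, u ≠ 0 ∧ (fun j => (u j).valMinAbs : Site 2) ∉ c.disk →
      ‖torusFourierInv (fun kv : TorusSite 2 L =>
          (fun y : Momentum => uvSymbolFn 1 klE0 (frameLevel μ 0 ((2 * π) • y)) (matsubaraFreq β M i))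
            (WithLp.toLp 2 fun j => ((kv j).val : ℝ) / L)) u‖ ≤
        (if ω₁ ≤ |matsubaraFreq β M i| then
          25 * (2 / |matsubaraFreq β M i|) * Real.exp (-(Real.arsinh (|matsubaraFreq β M i| / 4) * (c.Rc + 1))) else Real.sqrt Dlow0)) ∧
    (∀ i : MatsubaraIdx M, 0 ≤ (if ω₁ ≤ |matsubaraFreq β M i| then
          25 * (2 / |matsubaraFreq β M i|) * Real.exp (-(Real.arsinh (|matsubaraFreq β M i| / 4) * (c.Rc + 1))) else Real.sqrt Dlow0)) := by
  refine ⟨fun i u hu => ?_, fun i => by split_ifs <;> positivity⟩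
  split_ifs with hi
  · -- high shell: the `L`-condition at this frequency follows from the one at ω₁
    have homE : klE0 ≤ |matsubaraFreq β M i| := hω₁.trans hi
    have hρi : Real.exp (-(Real.arsinh (|matsubaraFreq β M i| / 4) * L / 2)) ≤ 1 / 2 := by
      refine le_trans ?_ hρ
      rw [Real.exp_le_exp]
      have hκle : Real.arsinh (ω₁ / 4) ≤ Real.arsinh (|matsubaraFreq β M i| / 4) := Real.arsinh_le_arsinh.2 (by linarith)
      have hL : (0 : ℝ) ≤ L := Nat.cast_nonneg L
      nlinarith
    exact norm_torusFourierInv_far_le_strip c μ homE hρi u hu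
  · exact norm_torusFourierInv_le_sqrt_of_l2Far c (hlow₀ i (not_le.1 hi)) u hu

omit [NeZero L] in
/-- **`S_far`**: `(1/β)·Σ_i Ψ i ≤ 50·e^{−κ₁(Rc+1)} + ω₁·√(Dlow 0)` for the two-shells family (`0 < β`, `klE0 ≤ ω₁`, `√(16+ω₁²) ≤ (Rc+1)ω₁`; any `Dlow 0`, read through `√`):
§3 for the high shell, k3c5's `sum_l2Far_low_le` (`Σ_i [|ω_i| < ω₁]·D ≤ βω₁D`) for the low shell. -/
theorem sum_farSup_family_le {M : ℕ} {β ω₁ : ℝ} (hβ : 0 < β) (hω₁ : klE0 ≤ ω₁) (Rc : ℕ)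
    (hR : Real.sqrt (16 + ω₁ ^ 2) ≤ ((Rc : ℝ) + 1) * ω₁) (Dlow0 : ℝ) :
    (1 / β) * ∑ i : MatsubaraIdx M, (if ω₁ ≤ |matsubaraFreq β M i| then
        25 * (2 / |matsubaraFreq β M i|) * Real.exp (-(Real.arsinh (|matsubaraFreq β M i| / 4) * (Rc + 1))) else Real.sqrt Dlow0) ≤
      50 * Real.exp (-(Real.arsinh (ω₁ / 4) * (Rc + 1))) + ω₁ * Real.sqrt Dlow0 := by
  have hE0 : (0 : ℝ) < klE0 := by norm_num [klE0]
  have hω₁0 : 0 < ω₁ := lt_of_lt_of_le hE0 hω₁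
  have hsplit : ∀ i : MatsubaraIdx M, (if ω₁ ≤ |matsubaraFreq β M i| then
        25 * (2 / |matsubaraFreq β M i|) * Real.exp (-(Real.arsinh (|matsubaraFreq β M i| / 4) * (Rc + 1))) else Real.sqrt Dlow0) =
      (if ω₁ ≤ |matsubaraFreq β M i| then
        25 * (2 / |matsubaraFreq β M i|) * Real.exp (-(Real.arsinh (|matsubaraFreq β M i| / 4) * (Rc + 1))) else 0) +
      (if |matsubaraFreq β M i| < ω₁ then Real.sqrt Dlow0 else 0) := by
    intro i
    by_cases h : ω₁ ≤ |matsubaraFreq β M i|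
    · rw [if_pos h, if_pos h, if_neg (not_lt.2 h), add_zero]
    · rw [if_neg h, if_neg h, if_pos (not_le.1 h), zero_add]
  simp_rw [hsplit]
  rw [Finset.sum_add_distrib]
  have h1 := sum_farSup_high_le (M := M) hβ hω₁ Rc hR
  have h2 := sum_l2Far_low_le hβ hω₁0 (Real.sqrt_nonneg Dlow0) M
  rw [one_div, inv_mul_le_iff₀ hβ]
  calc _ ≤ β * (50 * Real.exp (-(Real.arsinh (ω₁ / 4) * (Rc + 1)))) + β * ω₁ * Real.sqrt Dlow0 := add_le_add h1 h2
    _ = β * (50 * Real.exp (-(Real.arsinh (ω₁ / 4) * (Rc + 1))) + ω₁ * Real.sqrt Dlow0) := by ring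

end Summit.HubbardSuperconductivity.HubbardSuperconductivity.Theorems.KLRegimeSplit

end
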